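import Summits.RiemannHypothesis.RiemannHypothesis.Theorems.SignConeCondRungSOSFiftyFiveData

/-!
# Route SignCone — conditional rungs, IXa: SOS data for the von Mangoldt comb of length 55 — row chunks 0, 5–11, 12–19

Items stmt-RiemannHypothesis-16301/16302. Kernel-checked Dirichlet-SOS certificate (`crSOS55`: basis `1..82`, rank `42`, scale
`2^20`, `T = 111/2`; out-of-slab correction `Hsos` with frequencies `≥ log(111/2) > 2·(401/200)`) and the two-sided coefficient
table `coef55` (`|2Λ(n)/√n − q n| ≤ e n`, `Σ e n ≤ 10⁻⁵`) for the Platt–Trudgian instance of Theorem A at cutoff `2`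
(`SignConeCondRungPlattTrudgianTwo`): `honestComb 55 y − Hsos y ≤ sosBound + errTotal ≤ 18.1723` (vs the trivial bound `24.38`).
The bound `sosBound ≤ 18.17226` is certified in row chunks by `decide +kernel` (parts IXa/IXb).
-/

noncomputable section

-- `Summit.RiemannHypothesis.RiemannHypothesis.…` repeats a namespace component by design (D-0017 layout).
set_option linter.dupNamespace false

open scoped BigOperators
open Literature.Analysis.ValidatedNumerics.Numerics Literature.NumberTheory.LFunctions

namespace Summit.RiemannHypothesis.RiemannHypothesis.Theorems.SignCone

set_option maxHeartbeats 0 in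
/-- Row chunk `p' ∈ [0, 1)`. [folklore] -/
theorem crSOS55_chunk0 : (sumR 1 fun i => crSOS55.sosInner (List.range' 2 54) coef55.qAt (0 + i)) ≤ (1816557/100000) := by
  decide +kernel

set_option maxHeartbeats 0 in
/-- Row chunk `p' ∈ [5, 12)`. [folklore] -/
theorem crSOS55_chunk2 : (sumR 7 fun i => crSOS55.sosInner (List.range' 2 54) coef55.qAt (5 + i)) ≤ (591/500000) := by
  decide +kernel

set_option maxHeartbeats 0 in
/-- Row chunk `p' ∈ [12, 20)`. [folklore] -/
theorem crSOS55_chunk3 : (sumR 8 fun i => crSOS55.sosInner (List.range' 2 54) coef55.qAt (12 + i)) ≤ (1083/1000000) := by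
  decide +kernel

end Summit.RiemannHypothesis.RiemannHypothesis.Theorems.SignCone

end
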